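import Summits.QuantumFields.BalabanUV.Beta.FP.BlockTermsPieces

/-!
# `BalabanUV.Beta.FP.WindowedWordLedger` — road «FP» for binder row D1, ROW KER-γ (α2) ∕ (LEDGER) (owner memo `KER-GAMMA-ALPHA2.md` §9–§10, R-FP-36 (b),
# R-FP-37): THE LEDGER LINE OF A WINDOWED WORD WITH BOUNDED LEGS — the shape of the SEVEN gluon-core words `hL0`–`hL6` of the (LEDGER) skeleton
# `FineHessianNearLedger.hasym_PiBF_vertex2OfK_of_sliceLedger` (α2-b PART 3: a tadpole ∕ two-leg-bubble word on the window `‖s′−s‖∞ ≤ Nw` whose legs are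
# merely BOUNDED — `c•P_tt`, `R m`, `c•P_tt + R m` — and whose jets are bi-localised at O(1) rate), BY NAME over `WordPointwiseShape` at leg rate `r = 0`,
# the closed-form masses of `WordPointwiseShapeHk`, and F `FineSplitJunctionTwoLeg.rem_of_twoLeg`; every constant DISPLAYED

HONEST DEPENDENCY (page 1, mandatory): continuum YM on T⁴ ⇐ BetaPertH ∧ nine spine estimates (0/9 proved); BetaPertH ⇐ (D1) ∧ (D4) ∧
CAP+tail; G-an2-4 gates asym, D1 and NE2/3/4.  HONEST FRAMING (cell contract, verbatim): «discharging `BetaPertH` makes Bałaban's UV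
stability UNCONDITIONAL — a real constructive-QFT result; it is NOT the continuum limit and NOT the Clay problem.»  THIS MODULE is [folklore]
bookkeeping BY NAME (`abs_tadpole_le_wmass` ∕ `abs_biBubble_le_wmass` at `r = 0`, `wmass_le_of_biLoc`, `rem_of_twoLeg`, `MixLoopPowerCounting.sum_exp_le`,
`tadpole_shiftK` ∕ `BlockTermsPieces.biBubble_shiftK`).  No `def`, no `def … : Prop`, nothing cited, nothing of the manuscripts under audit asserted, 0 sorry.
The letters of the road's objects (`Bdd` constants of `P_tt`, `R m`; `BiLoc` constants of the slice stencils ∕ bi-tables ∕ defects; the columns' (J)(J′);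
their N-powers) are DISPLAYED — the m-freeness of the resulting ledger numbers is the (γ)∕(LEDGER) arithmetic, decided by nobody here.  NOT (LEDGER)'s numbers,
NOT hsplit, NOT (ASYMP), NOT D1; 0∕4 row-D1 binders; NOT BetaPertH, NOT continuum, NOT Clay.  «not in print; our bookkeeping».

ABSOLUTE RULE (cell charter, verbatim): «No internally-minted statement may enter as a cited fact. Every hypothesis is either kernel-proved in this
package or a verbatim quotation of a PUBLISHED theorem with page reference. The manuscript(s) under audit are NOT citable for their own disputed
steps — they are the thing under adjudication; programme-internal (2001/route/tribunal) claims are never citable.»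

WHY THE RATE-0 READING CLOSES ON THE WINDOW.  A bounded leg is `Decays A CA 0`; at `r = 0` the r-weighted masses are plain ℓ¹ masses and the word bound
carries NO decay in `‖s′−s‖∞` — but the piece is WINDOWED, and on `‖s′−s‖∞ ≤ Nw` one has `1 ≤ e^{2δ₁Nw∕N}·e^{−(2δ₁∕N)‖s′−s‖∞}` for ANY `δ₁ ≥ 0`, so F's (hk)
holds with `E₀ := |t|·CA(·CB)·(masses)·e^{2δ₁Nw∕N}`, `M₁ = M₂ = 1`, at the rate `δ₁` of the columns' (J) letter; the window letters (A₁)(A₂) are then the pure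
exponential sum `Σ_{p∈T} e^{−(δ₁∕(2N))‖p−q‖∞} ≤ (1 + 480·e^{δ₁∕4}·(4∕δ₁)⁴)·N⁴`.

CONTENT ([folklore]).
* §1 bricks: `decays_zero_of_bdd`, `exp_window_le` (the window inequality), `window_sum_exp_le` (the (A₁)(A₂) letter for unit masses, `= W(δ₁)·N⁴`).
* §2 **`hk_window_tadpole_bdd`**, `isBlockPeriodic_window_tadpole`, **`ledger_window_tadpole_bdd`** — the windowed tadpole word
  `G c e s s′ := 𝟙[‖s′−s‖∞ ≤ Nw]·t·tadpole A (Wb c s e s′)` (`Bdd A CA`, `BiLoc (Wb c s e s′) s s′ C2 δ`): ledger line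
  `≤ 16·(3·(1+20∕δ₁²)·(|t|·CA·((card F)²·C2·Zl(δ)²)·e^{2δ₁Nw∕N})·C_J·C_J′·(W(δ₁)N⁴)·(W(δ₁)N⁴))` — the shape of `hL0`, `hL4`.
* §3 **`hk_window_biBubble_bdd`**, `isBlockPeriodic_window_biBubble`, **`ledger_window_biBubble_bdd`** — the windowed two-leg bubble word
  `𝟙·t·biBubble A (V₁ c s) B (V₂ e s′)` (`Bdd A CA`, `Bdd B CB`, `BiLoc (V₁ c s) s s Cv₁ δ`, `BiLoc (V₂ e s′) s′ s′ Cv₂ δ`): ledger line with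
  `E₀ = |t|·CA·CB·((card F)²·Cv₁·Zl(δ)²)·((card F)²·Cv₂·Zl(δ)²)·e^{2δ₁Nw∕N}` — the shape of `hL1`, `hL2`, `hL3`, `hL5`, `hL6` (`tr((A∘V₁)∘(B∘V₂)) = biBubble A V₁ B V₂`,
  `bubble A V₁ V₂ = biBubble A V₁ A V₂` by `rfl`; differences `Ssl − a•V_tt` are bi-localised by `KernelWard.biLoc_sub` ∕ `StepJetData.biLoc_smul`).
Provenance: D1 formalisation swarm LEAF PROVER 01, unit `b2b-balaban-beta-d1-formalise-leaf-01` gen 12, 2026-08-21, road FP row KER-γ (LEDGER) supplier.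
-/

noncomputable section

namespace Summit.QuantumFields.BalabanUV.Beta.FP.WindowedWordLedger

open Finset
open scoped BigOperators
open Literature.MathematicalPhysics.QuantumFieldTheory.Balaban1983to89
open Literature.MathematicalPhysics.QuantumFieldTheory.Balaban1983to89.Beta
open B12Sec2to5 (l1)
open ExpKernelCalculus (Site MKer Decays BiLoc comp tr bubble tadpole shiftK Zl Zl_nonneg tadpole_shiftK)
open KernelWard (Bdd)
open OneStepResolventKernel (Fib)
open OneStepKernelFamily (colH)
open DyadicShell (Pt supNorm)
open GradedBubbles (supNorm_neg)
open Summit.QuantumFields.BalabanUV.Beta.D1BFx.PackedKernelSplit (biBubble)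
open Summit.QuantumFields.BalabanUV.Beta.D1BFx.MomentTransferPeriodic (IsBlockPeriodic)
open Summit.QuantumFields.BalabanUV.Beta.D1BFx.MomentTransferPeriodicEntry (EKer₂ dressedEntryP)
open Summit.QuantumFields.BalabanUV.Beta.FP.TransportInfinityM (colOf)
open Summit.QuantumFields.BalabanUV.Beta.FP.MixLoopPowerCounting (sum_exp_le supNorm_cast_nonneg)
open Summit.QuantumFields.BalabanUV.Beta.FP.WordPointwiseShape (abs_tadpole_le_wmass abs_biBubble_le_wmass)
open Summit.QuantumFields.BalabanUV.Beta.FP.WordPointwiseShapeHk (wmass_le_of_biLoc)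
open Summit.QuantumFields.BalabanUV.Beta.FP.BlockTermsPieces (biBubble_shiftK)
open Summit.QuantumFields.BalabanUV.Beta.FP.FineSplitJunctionTwoLeg (rem_of_twoLeg)

variable {F : Type*} [Fintype F]

/-! ## §1 Bricks -/

omit [Fintype F] in
/-- [folklore] a bounded leg is a leg of rate `0`. -/
theorem decays_zero_of_bdd {D : ℕ} {A : MKer D F} {C : ℝ} (h : Bdd A C) : Decays A C 0 :=
  fun x y a b => by simpa using h x y a b

/-- [folklore] **THE WINDOW INEQUALITY**: on `‖z‖∞ ≤ Nw`, `1 ≤ e^{2δ₁Nw∕N}·e^{−(2δ₁∕N)‖z‖∞}` (`0 ≤ δ₁`). -/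
theorem exp_window_le {δ₁ : ℝ} (hδ₁ : 0 ≤ δ₁) {N Nw : ℕ} {z : Pt} (hz : supNorm z ≤ Nw) :
    (1 : ℝ) ≤ Real.exp (2 * δ₁ * Nw / N) * Real.exp (-(2 * δ₁ / N) * (supNorm z : ℝ)) := by
  rw [← Real.exp_add]
  apply Real.one_le_exp
  have hz' : (supNorm z : ℝ) ≤ Nw := by exact_mod_cast hz
  rcases Nat.eq_zero_or_pos N with hN | hN
  · subst hN; simp
  · have hN' : (0 : ℝ) < N := by exact_mod_cast hN
    have : 2 * δ₁ * Nw / N - (2 * δ₁ / N) * (supNorm z : ℝ) = (2 * δ₁ / N) * ((Nw : ℝ) - supNorm z) := by ring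
    have h2 : 0 ≤ (2 * δ₁ / N) * ((Nw : ℝ) - supNorm z) := mul_nonneg (by positivity) (by linarith)
    linarith

/-- [folklore] **THE WINDOW LETTER FOR UNIT MASSES**: `Σ_{p∈T} e^{−(δ₁∕(2N))‖p−q‖∞} ≤ (1 + 480·e^{δ₁∕4}·(4∕δ₁)⁴)·N⁴` (every centre `q`, every finite `T`;
`MixLoopPowerCounting.sum_exp_le` at rate `δ₁∕2` after translating by `q`). -/
theorem window_sum_exp_le {δ₁ : ℝ} (hδ₁ : 0 < δ₁) {N : ℕ} (hN : 1 ≤ N) (q : Pt) (T : Finset Pt) :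
    ∑ p ∈ T, Real.exp (-(δ₁ / (2 * N)) * (supNorm (p - q) : ℝ)) * (1 : ℝ)
      ≤ (1 + 480 * Real.exp (δ₁ / 4) * (4 / δ₁) ^ 4) * (N : ℝ) ^ 4 := by
  classical
  have h := sum_exp_le (δ := δ₁ / 2) (half_pos hδ₁) hN (T.image fun p => p - q)
  have e1 : δ₁ / 2 / 2 = δ₁ / 4 := by ring
  have e2 : (2 : ℝ) / (δ₁ / 2) = 4 / δ₁ := by field_simp; ring
  have e3 : δ₁ / 2 / (N : ℝ) = δ₁ / (2 * N) := by rw [div_div]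
  rw [e1, e2, e3] at h
  rw [Finset.sum_image (fun x _ y _ hxy => sub_left_injective hxy)] at h
  simpa only [mul_one] using h

/-! ## §2 The windowed tadpole word with a bounded leg -/

section Tadpole

variable [Nonempty F] {N Nw : ℕ} {A : MKer 4 F} {Wb : Fin 4 → Pt → Fin 4 → Pt → MKer 4 F} {CA C2 δ δ₁ t : ℝ}

/-- **(hk) FOR THE WINDOWED TADPOLE WORD** [folklore]: `Bdd A CA`, `BiLoc (Wb c s e s′) s s′ C2 δ` (`0 < δ`), `0 ≤ δ₁` ⟹
`|𝟙[‖s′−s‖∞ ≤ Nw]·t·tadpole A (Wb c s e s′)| ≤ 1·1·(|t|·CA·((card F)²·C2·Zl(δ)²)·e^{2δ₁Nw∕N})·e^{−(2δ₁∕N)‖s′−s‖∞}` — F's (hk) with unit masses. -/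
theorem hk_window_tadpole_bdd (hA : Bdd A CA) (hWb : ∀ c s e s', BiLoc (Wb c s e s') s s' C2 δ) (hδ : 0 < δ) (hδ₁ : 0 ≤ δ₁)
    (c e : Fin 4) (s s' : Pt) :
    |(if supNorm (s' - s) ≤ Nw then t * tadpole A (Wb c s e s') else 0)|
      ≤ 1 * 1 * (|t| * CA * ((Fintype.card F : ℝ) ^ 2 * C2 * Zl 4 δ ^ 2) * Real.exp (2 * δ₁ * Nw / N))
          * Real.exp (-(2 * δ₁ / N) * (supNorm (s' - s) : ℝ)) := by
  obtain ⟨a₀⟩ := ‹Nonempty F›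
  have hCA : 0 ≤ CA := (abs_nonneg _).trans (hA 0 0 a₀ a₀)
  have hC2 : 0 ≤ C2 := (hWb c s e s').nonneg a₀
  have hM : ∀ T : Finset (Site 4 × Site 4), ∑ yz ∈ T, ∑ f, ∑ g,
      Real.exp (0 * l1 (yz.1 - s)) * Real.exp (0 * l1 (yz.2 - s')) * |Wb c s e s' yz.1 yz.2 f g|
        ≤ (Fintype.card F : ℝ) ^ 2 * C2 * Zl 4 (δ - 0) ^ 2 := fun T => wmass_le_of_biLoc (hWb c s e s') (by linarith) T
  rw [sub_zero] at hM
  have hw := abs_tadpole_le_wmass (decays_zero_of_bdd hA) le_rfl hM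
  have hw' : |tadpole A (Wb c s e s')| ≤ CA * ((Fintype.card F : ℝ) ^ 2 * C2 * Zl 4 δ ^ 2) := by simpa using hw
  have hR : 0 ≤ 1 * 1 * (|t| * CA * ((Fintype.card F : ℝ) ^ 2 * C2 * Zl 4 δ ^ 2) * Real.exp (2 * δ₁ * Nw / N))
      * Real.exp (-(2 * δ₁ / N) * (supNorm (s' - s) : ℝ)) := by positivity
  split_ifs with hwin
  · rw [abs_mul]
    have hwin' := exp_window_le (N := N) hδ₁ hwin
    calc |t| * |tadpole A (Wb c s e s')|
        ≤ |t| * (CA * ((Fintype.card F : ℝ) ^ 2 * C2 * Zl 4 δ ^ 2)) * 1 := by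
          rw [mul_one]; exact mul_le_mul_of_nonneg_left hw' (abs_nonneg _)
      _ ≤ |t| * (CA * ((Fintype.card F : ℝ) ^ 2 * C2 * Zl 4 δ ^ 2)) *
            (Real.exp (2 * δ₁ * Nw / N) * Real.exp (-(2 * δ₁ / N) * (supNorm (s' - s) : ℝ))) :=
          mul_le_mul_of_nonneg_left hwin' (by positivity)
      _ = _ := by ring
  · simpa using hR

omit [Nonempty F] in
/-- [folklore] the windowed tadpole word is jointly `N`-block periodic (leg `N`-block covariant, bi-tables `N`-block covariant). -/
theorem isBlockPeriodic_window_tadpole (hAcov : ∀ v : Site 4, shiftK (-((N : ℤ) • v)) A = A)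
    (hWcov : ∀ (c : Fin 4) (s : Pt) (e : Fin 4) (s' v : Pt), Wb c (s + (N : ℤ) • v) e (s' + (N : ℤ) • v) = shiftK (-((N : ℤ) • v)) (Wb c s e s'))
    (c e : Fin 4) :
    IsBlockPeriodic N (fun s s' => if supNorm (s' - s) ≤ Nw then t * tadpole A (Wb c s e s') else 0) := by
  intro v s s'
  have ew : supNorm (s' + (N : ℤ) • v - (s + (N : ℤ) • v)) = supNorm (s' - s) := by rw [add_sub_add_right_eq_sub]
  simp only [ew]
  rw [hWcov]
  conv_lhs => rw [← hAcov v, tadpole_shiftK]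

variable {K : MKer (3 + 1) (Fib 3)} {C_J C_J' : ℝ} {a b : Fin 4}

/-- **THE LEDGER LINE OF A WINDOWED TADPOLE WORD WITH A BOUNDED LEG** [folklore] (the shape of `hL0`, `hL4` of the (LEDGER) skeleton): `K` block-covariant with
absolutely summable END columns and the column letters (J) (rate `δ₁∕N`, anchor `0`) ∕ (J′); `Bdd A CA` with `A` `N`-block covariant; bi-tables `Wb c s e s′`
bi-localised at `(s,s′)` with constant `C2`, rate `δ`, `N`-block covariant ⟹ `∀ S′, Σ_{u∈S′}‖u‖∞²·|dressedEntryP (c a′ ↦ colH K N a′ 0 c)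
(𝟙[‖s′−s‖∞ ≤ Nw]·t·tadpole A (Wb c s e s′)) (N•(−u)) a b| ≤ 16·(3·(1+20∕δ₁²)·E₀·C_J·C_J′·W·W)` with `E₀ = |t|·CA·((card F)²·C2·Zl(δ)²)·e^{2δ₁Nw∕N}`,
`W = (1 + 480·e^{δ₁∕4}·(4∕δ₁)⁴)·N⁴` — every constant displayed. -/
theorem ledger_window_tadpole_bdd (hδ : 0 < δ) (hδ₁ : 0 < δ₁) (hN : 1 ≤ N)
    (hKcov : ∀ v : Fin (3 + 1) → ℤ, shiftK (-((N : ℤ) • v)) K = K) (hcol : ∀ κ l : Fin 4, Summable fun x => |colOf K κ l x|)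
    (hAcov : ∀ v : Site 4, shiftK (-((N : ℤ) • v)) A = A)
    (hWcov : ∀ (c : Fin 4) (s : Pt) (e : Fin 4) (s' v : Pt), Wb c (s + (N : ℤ) • v) e (s' + (N : ℤ) • v) = shiftK (-((N : ℤ) • v)) (Wb c s e s'))
    (hA : Bdd A CA) (hWb : ∀ c s e s', BiLoc (Wb c s e s') s s' C2 δ)
    (hJ : ∀ (c : Fin 4) (p : Pt), |colH K N a 0 c p| ≤ C_J * Real.exp (-(δ₁ / N) * (supNorm (p - (N : ℤ) • (0 : Pt)) : ℝ)))
    (hJ' : ∀ (e : Fin 4) (S' : Finset Pt) (x : Pt), ∑ u ∈ S', (1 + ((supNorm (x - (N : ℤ) • u) : ℝ) / N) ^ 2) * |colH K N b u e x| ≤ C_J') :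
    ∀ S' : Finset Pt, ∑ u ∈ S', (supNorm u : ℝ) ^ 2 *
        |dressedEntryP (fun c a' => colH K N a' 0 c) (fun c e s s' => if supNorm (s' - s) ≤ Nw then t * tadpole A (Wb c s e s') else 0)
          ((N : ℤ) • (-u)) a b|
      ≤ 16 * (3 * (1 + 20 / δ₁ ^ 2) * (|t| * CA * ((Fintype.card F : ℝ) ^ 2 * C2 * Zl 4 δ ^ 2) * Real.exp (2 * δ₁ * Nw / N)) * C_J * C_J'
          * ((1 + 480 * Real.exp (δ₁ / 4) * (4 / δ₁) ^ 4) * (N : ℝ) ^ 4) * ((1 + 480 * Real.exp (δ₁ / 4) * (4 / δ₁) ^ 4) * (N : ℝ) ^ 4)) := by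
  obtain ⟨a₀⟩ := ‹Nonempty F›
  have hCA : 0 ≤ CA := (abs_nonneg _).trans (hA 0 0 a₀ a₀)
  have hC2 : 0 ≤ C2 := (hWb 0 0 0 0).nonneg a₀
  have hE₀ : 0 ≤ |t| * CA * ((Fintype.card F : ℝ) ^ 2 * C2 * Zl 4 δ ^ 2) * Real.exp (2 * δ₁ * Nw / N) := by
    have := Zl_nonneg (D := 4) hδ; positivity
  exact rem_of_twoLeg (G := fun c e s s' => if supNorm (s' - s) ≤ Nw then t * tadpole A (Wb c s e s') else 0)
    (M₁ := fun _ _ _ => 1) (M₂ := fun _ _ _ => 1) hδ₁ hN hKcov hcol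
    (fun c e => isBlockPeriodic_window_tadpole hAcov hWcov c e)
    (fun c e => ⟨_, fun s s' => (hk_window_tadpole_bdd (N := N) (Nw := Nw) (t := t) hA hWb hδ hδ₁.le c e s s').trans (by
      refine mul_le_of_le_one_right (by positivity) (Real.exp_le_one_iff.mpr ?_)
      have h0 := supNorm_cast_nonneg (s' - s)
      have h1 : 0 ≤ 2 * δ₁ / N := by positivity
      nlinarith)⟩)
    hE₀ (fun _ _ _ => zero_le_one) (fun _ _ _ => zero_le_one)
    (fun c e p x => hk_window_tadpole_bdd hA hWb hδ hδ₁.le c e p x)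
    (fun _ _ q T => window_sum_exp_le hδ₁ hN q T) (fun _ _ q T => window_sum_exp_le hδ₁ hN q T) hJ hJ'

end Tadpole

/-! ## §3 The windowed two-leg bubble word with bounded legs -/

section Bubble

variable [Nonempty F] {N Nw : ℕ} {A B : MKer 4 F} {V₁ V₂ : Fin 4 → Pt → MKer 4 F} {CA CB Cv₁ Cv₂ δ δ₁ t : ℝ}

/-- **(hk) FOR THE WINDOWED TWO-LEG BUBBLE WORD** [folklore]: `Bdd A CA`, `Bdd B CB`, `BiLoc (V₁ c s) s s Cv₁ δ`, `BiLoc (V₂ e s′) s′ s′ Cv₂ δ` (`0 < δ`),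
`0 ≤ δ₁` ⟹ `|𝟙[‖s′−s‖∞ ≤ Nw]·t·biBubble A (V₁ c s) B (V₂ e s′)| ≤ 1·1·E₀·e^{−(2δ₁∕N)‖s′−s‖∞}` with
`E₀ = |t|·CA·CB·((card F)²·Cv₁·Zl(δ)²)·((card F)²·Cv₂·Zl(δ)²)·e^{2δ₁Nw∕N}`. -/
theorem hk_window_biBubble_bdd (hA : Bdd A CA) (hB : Bdd B CB) (hV₁ : ∀ c s, BiLoc (V₁ c s) s s Cv₁ δ) (hV₂ : ∀ e s', BiLoc (V₂ e s') s' s' Cv₂ δ)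
    (hδ : 0 < δ) (hδ₁ : 0 ≤ δ₁) (c e : Fin 4) (s s' : Pt) :
    |(if supNorm (s' - s) ≤ Nw then t * biBubble A (V₁ c s) B (V₂ e s') else 0)|
      ≤ 1 * 1 * (|t| * CA * CB * ((Fintype.card F : ℝ) ^ 2 * Cv₁ * Zl 4 δ ^ 2) * ((Fintype.card F : ℝ) ^ 2 * Cv₂ * Zl 4 δ ^ 2)
          * Real.exp (2 * δ₁ * Nw / N)) * Real.exp (-(2 * δ₁ / N) * (supNorm (s' - s) : ℝ)) := by
  obtain ⟨a₀⟩ := ‹Nonempty F›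
  have hCA : 0 ≤ CA := (abs_nonneg _).trans (hA 0 0 a₀ a₀)
  have hCB : 0 ≤ CB := (abs_nonneg _).trans (hB 0 0 a₀ a₀)
  have hC1 : 0 ≤ Cv₁ := (hV₁ c s).nonneg a₀
  have hC2 : 0 ≤ Cv₂ := (hV₂ e s').nonneg a₀
  have hMv : ∀ T : Finset (Site 4 × Site 4), ∑ yz ∈ T, ∑ f, ∑ g,
      Real.exp (0 * l1 (yz.1 - s)) * Real.exp (0 * l1 (yz.2 - s)) * |V₁ c s yz.1 yz.2 f g|
        ≤ (Fintype.card F : ℝ) ^ 2 * Cv₁ * Zl 4 (δ - 0) ^ 2 := fun T => wmass_le_of_biLoc (hV₁ c s) (by linarith) T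
  have hMw : ∀ T : Finset (Site 4 × Site 4), ∑ yz ∈ T, ∑ f, ∑ g,
      Real.exp (0 * l1 (yz.1 - s')) * Real.exp (0 * l1 (yz.2 - s')) * |V₂ e s' yz.1 yz.2 f g|
        ≤ (Fintype.card F : ℝ) ^ 2 * Cv₂ * Zl 4 (δ - 0) ^ 2 := fun T => wmass_le_of_biLoc (hV₂ e s') (by linarith) T
  rw [sub_zero] at hMv hMw
  have hw := abs_biBubble_le_wmass (decays_zero_of_bdd hA) (decays_zero_of_bdd hB) le_rfl hMv hMw
  have hw' : |biBubble A (V₁ c s) B (V₂ e s')|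
      ≤ CA * CB * ((Fintype.card F : ℝ) ^ 2 * Cv₁ * Zl 4 δ ^ 2) * ((Fintype.card F : ℝ) ^ 2 * Cv₂ * Zl 4 δ ^ 2) := by
    simpa using hw
  have hR : 0 ≤ 1 * 1 * (|t| * CA * CB * ((Fintype.card F : ℝ) ^ 2 * Cv₁ * Zl 4 δ ^ 2) * ((Fintype.card F : ℝ) ^ 2 * Cv₂ * Zl 4 δ ^ 2)
      * Real.exp (2 * δ₁ * Nw / N)) * Real.exp (-(2 * δ₁ / N) * (supNorm (s' - s) : ℝ)) := by
    have := Zl_nonneg (D := 4) hδ; positivity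
  split_ifs with hwin
  · rw [abs_mul]
    have hwin' := exp_window_le (N := N) hδ₁ hwin
    calc |t| * |biBubble A (V₁ c s) B (V₂ e s')|
        ≤ |t| * (CA * CB * ((Fintype.card F : ℝ) ^ 2 * Cv₁ * Zl 4 δ ^ 2) * ((Fintype.card F : ℝ) ^ 2 * Cv₂ * Zl 4 δ ^ 2)) * 1 := by
          rw [mul_one]; exact mul_le_mul_of_nonneg_left hw' (abs_nonneg _)
      _ ≤ |t| * (CA * CB * ((Fintype.card F : ℝ) ^ 2 * Cv₁ * Zl 4 δ ^ 2) * ((Fintype.card F : ℝ) ^ 2 * Cv₂ * Zl 4 δ ^ 2)) *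
            (Real.exp (2 * δ₁ * Nw / N) * Real.exp (-(2 * δ₁ / N) * (supNorm (s' - s) : ℝ))) :=
          mul_le_mul_of_nonneg_left hwin' (by
            have := Zl_nonneg (D := 4) hδ; positivity)
      _ = _ := by ring
  · simpa using hR

omit [Nonempty F] in
/-- [folklore] the windowed two-leg bubble word is jointly `N`-block periodic. -/
theorem isBlockPeriodic_window_biBubble (hAcov : ∀ v : Site 4, shiftK (-((N : ℤ) • v)) A = A) (hBcov : ∀ v : Site 4, shiftK (-((N : ℤ) • v)) B = B)
    (hV₁cov : ∀ (c : Fin 4) (s v : Pt), V₁ c (s + (N : ℤ) • v) = shiftK (-((N : ℤ) • v)) (V₁ c s))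
    (hV₂cov : ∀ (e : Fin 4) (s' v : Pt), V₂ e (s' + (N : ℤ) • v) = shiftK (-((N : ℤ) • v)) (V₂ e s'))
    (c e : Fin 4) :
    IsBlockPeriodic N (fun s s' => if supNorm (s' - s) ≤ Nw then t * biBubble A (V₁ c s) B (V₂ e s') else 0) := by
  intro v s s'
  have ew : supNorm (s' + (N : ℤ) • v - (s + (N : ℤ) • v)) = supNorm (s' - s) := by rw [add_sub_add_right_eq_sub]
  simp only [ew]
  rw [hV₁cov, hV₂cov]
  conv_lhs => rw [← hAcov v, ← hBcov v, biBubble_shiftK]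

variable {K : MKer (3 + 1) (Fib 3)} {C_J C_J' : ℝ} {a b : Fin 4}

/-- **THE LEDGER LINE OF A WINDOWED TWO-LEG BUBBLE WORD WITH BOUNDED LEGS** [folklore] (the shape of `hL1`, `hL2`, `hL3`, `hL5`, `hL6`): as in §2 with two bounded
`N`-block covariant legs and two families of bi-localised, `N`-block covariant stencils ⟹ the ledger line with
`E₀ = |t|·CA·CB·((card F)²·Cv₁·Zl(δ)²)·((card F)²·Cv₂·Zl(δ)²)·e^{2δ₁Nw∕N}` and the unit-mass window letters `W = (1 + 480·e^{δ₁∕4}·(4∕δ₁)⁴)·N⁴`. -/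
theorem ledger_window_biBubble_bdd (hδ : 0 < δ) (hδ₁ : 0 < δ₁) (hN : 1 ≤ N)
    (hKcov : ∀ v : Fin (3 + 1) → ℤ, shiftK (-((N : ℤ) • v)) K = K) (hcol : ∀ κ l : Fin 4, Summable fun x => |colOf K κ l x|)
    (hAcov : ∀ v : Site 4, shiftK (-((N : ℤ) • v)) A = A) (hBcov : ∀ v : Site 4, shiftK (-((N : ℤ) • v)) B = B)
    (hV₁cov : ∀ (c : Fin 4) (s v : Pt), V₁ c (s + (N : ℤ) • v) = shiftK (-((N : ℤ) • v)) (V₁ c s))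
    (hV₂cov : ∀ (e : Fin 4) (s' v : Pt), V₂ e (s' + (N : ℤ) • v) = shiftK (-((N : ℤ) • v)) (V₂ e s'))
    (hA : Bdd A CA) (hB : Bdd B CB) (hV₁ : ∀ c s, BiLoc (V₁ c s) s s Cv₁ δ) (hV₂ : ∀ e s', BiLoc (V₂ e s') s' s' Cv₂ δ)
    (hJ : ∀ (c : Fin 4) (p : Pt), |colH K N a 0 c p| ≤ C_J * Real.exp (-(δ₁ / N) * (supNorm (p - (N : ℤ) • (0 : Pt)) : ℝ)))
    (hJ' : ∀ (e : Fin 4) (S' : Finset Pt) (x : Pt), ∑ u ∈ S', (1 + ((supNorm (x - (N : ℤ) • u) : ℝ) / N) ^ 2) * |colH K N b u e x| ≤ C_J') :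
    ∀ S' : Finset Pt, ∑ u ∈ S', (supNorm u : ℝ) ^ 2 *
        |dressedEntryP (fun c a' => colH K N a' 0 c)
          (fun c e s s' => if supNorm (s' - s) ≤ Nw then t * biBubble A (V₁ c s) B (V₂ e s') else 0) ((N : ℤ) • (-u)) a b|
      ≤ 16 * (3 * (1 + 20 / δ₁ ^ 2)
          * (|t| * CA * CB * ((Fintype.card F : ℝ) ^ 2 * Cv₁ * Zl 4 δ ^ 2) * ((Fintype.card F : ℝ) ^ 2 * Cv₂ * Zl 4 δ ^ 2)
              * Real.exp (2 * δ₁ * Nw / N)) * C_J * C_J'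
          * ((1 + 480 * Real.exp (δ₁ / 4) * (4 / δ₁) ^ 4) * (N : ℝ) ^ 4) * ((1 + 480 * Real.exp (δ₁ / 4) * (4 / δ₁) ^ 4) * (N : ℝ) ^ 4)) := by
  obtain ⟨a₀⟩ := ‹Nonempty F›
  have hCA : 0 ≤ CA := (abs_nonneg _).trans (hA 0 0 a₀ a₀)
  have hCB : 0 ≤ CB := (abs_nonneg _).trans (hB 0 0 a₀ a₀)
  have hC1 : 0 ≤ Cv₁ := (hV₁ 0 0).nonneg a₀
  have hC2 : 0 ≤ Cv₂ := (hV₂ 0 0).nonneg a₀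
  have hE₀ : 0 ≤ |t| * CA * CB * ((Fintype.card F : ℝ) ^ 2 * Cv₁ * Zl 4 δ ^ 2) * ((Fintype.card F : ℝ) ^ 2 * Cv₂ * Zl 4 δ ^ 2)
      * Real.exp (2 * δ₁ * Nw / N) := by
    have := Zl_nonneg (D := 4) hδ; positivity
  exact rem_of_twoLeg (G := fun c e s s' => if supNorm (s' - s) ≤ Nw then t * biBubble A (V₁ c s) B (V₂ e s') else 0)
    (M₁ := fun _ _ _ => 1) (M₂ := fun _ _ _ => 1) hδ₁ hN hKcov hcol
    (fun c e => isBlockPeriodic_window_biBubble hAcov hBcov hV₁cov hV₂cov c e)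
    (fun c e => ⟨_, fun s s' => (hk_window_biBubble_bdd (N := N) (Nw := Nw) (t := t) hA hB hV₁ hV₂ hδ hδ₁.le c e s s').trans (by
      refine mul_le_of_le_one_right (by have := Zl_nonneg (D := 4) hδ; positivity) (Real.exp_le_one_iff.mpr ?_)
      have h0 := supNorm_cast_nonneg (s' - s)
      have h1 : 0 ≤ 2 * δ₁ / N := by positivity
      nlinarith)⟩)
    hE₀ (fun _ _ _ => zero_le_one) (fun _ _ _ => zero_le_one)
    (fun c e p x => hk_window_biBubble_bdd hA hB hV₁ hV₂ hδ hδ₁.le c e p x)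
    (fun _ _ q T => window_sum_exp_le hδ₁ hN q T) (fun _ _ q T => window_sum_exp_le hδ₁ hN q T) hJ hJ'

end Bubble

end Summit.QuantumFields.BalabanUV.Beta.FP.WindowedWordLedger

end
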